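import Summits.AtomisticToContinuum.FouriersLaw.Theses.HiddenChargeMazur
import Literature.MathematicalPhysics.KineticTheory.LangevinSemigroup

/-!
# `BridgeGlue` (route HiddenChargeMazur, item stmt-AtomisticToContinuum-13515)

The glue of the open-chain Mazur bridge: `StaticKubo → ThomsonBound → DressedCharge → OpenMazurBridge`.
Pure bookkeeping.  Given the odd local charge at `(ω₂, lam, β, γ, T)` and `h : FouriersLawFor (pinnedChain …)`:
clause (i) of `h` gives weak-NESS uniqueness (in the `μ = ν` form) and, by choice, a family of steady
states; clause (ii) gives `κ` and the response limits `D : ℕ → ℝ` at `T` with `D N → κ T`, hence `D N ≤ M`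
for all `N`.  `DressedCharge` gives `c > 0`, `C`, `N₀`; for a suitable large `N ≥ max N₀ 2`, `StaticKubo`
(with `D := D N`) gives the Poisson solution `F` with `D N · (N−1) T² = ∫ F·J dGibbs`, `DressedCharge` gives
the dressed test functions `G, wL, wR` (one common `e^{θH}` growth pair because `H ≥ 0` for the pinned
chain), and `ThomsonBound` yields `γ (c N)² ≤ γ (∫ J G)² ≤ D N (N−1) T² · leak(γ) ≤ M (N−1) T² C (1+γ²)`
(the leak is `≥ 0` as a sum of integrals of squares), i.e. `γ c² N ≤ K`, absurd for the chosen `N`.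
-/

namespace Summit.AtomisticToContinuum.FouriersLaw.Theorems

open MeasureTheory Filter Topology
open Literature.MathematicalPhysics.KineticTheory.HeatConduction
open Summit.AtomisticToContinuum.FouriersLaw.Theses.HiddenChargeMazur

/-- Arithmetic core of the glue: with `X = ∫ J G`, `Y = ∫ F J = D (N-1) T²`, `L` the (nonnegative) leak,
the Thomson inequality `γ X² ≤ Y L`, the overlap `c N ≤ X`, the bounds `D ≤ M`, `L ≤ C (1+γ²)` and
`K / (γ c²) < N` for `K = max (M T² C (1+γ²)) 0` are contradictory. -/
theorem hiddenChargeMazur_bridgeGlue_arith {γ c C M T K X Y L D : ℝ} {N : ℕ}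
    (hγ : 0 < γ) (hc : 0 < c) (hN : 2 ≤ N)
    (hK : K = max (M * T ^ 2 * (C * (1 + γ ^ 2))) 0)
    (hNK : K / (γ * c ^ 2) < N)
    (hD : D ≤ M) (hY : D * (((N : ℝ) - 1) * T ^ 2) = Y)
    (hTh : γ * X ^ 2 ≤ Y * L) (hL0 : 0 ≤ L) (hLC : L ≤ C * (1 + γ ^ 2))
    (hX : c * (N : ℝ) ≤ X) : False := by
  have hN1 : (1 : ℝ) ≤ N := by exact_mod_cast le_trans (by norm_num) hN
  have hK0 : 0 ≤ K := by rw [hK]; exact le_max_right _ _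
  have hK1 : M * T ^ 2 * (C * (1 + γ ^ 2)) ≤ K := by rw [hK]; exact le_max_left _ _
  have hcN : 0 ≤ c * N := by positivity
  have hX2 : (c * N) ^ 2 ≤ X ^ 2 := pow_le_pow_left₀ hcN hX 2
  have hYL : Y * L ≤ K * N := by
    by_cases hY0 : 0 ≤ Y
    · have hCg : 0 ≤ C * (1 + γ ^ 2) := hL0.trans hLC
      have hNT : 0 ≤ ((N : ℝ) - 1) * T ^ 2 := by nlinarith
      calc Y * L ≤ Y * (C * (1 + γ ^ 2)) := mul_le_mul_of_nonneg_left hLC hY0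
        _ = D * (((N : ℝ) - 1) * T ^ 2) * (C * (1 + γ ^ 2)) := by rw [hY]
        _ ≤ M * (((N : ℝ) - 1) * T ^ 2) * (C * (1 + γ ^ 2)) :=
            mul_le_mul_of_nonneg_right (mul_le_mul_of_nonneg_right hD hNT) hCg
        _ = ((N : ℝ) - 1) * (M * T ^ 2 * (C * (1 + γ ^ 2))) := by ring
        _ ≤ ((N : ℝ) - 1) * K := mul_le_mul_of_nonneg_left hK1 (by linarith)
        _ ≤ K * N := by nlinarith
    · have hY0' : Y < 0 := not_le.mp hY0
      calc Y * L ≤ 0 := mul_nonpos_iff.mpr (Or.inr ⟨hY0'.le, hL0⟩)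
        _ ≤ K * N := by positivity
  have hγc : 0 < γ * c ^ 2 := by positivity
  have hKN : K < N * (γ * c ^ 2) := (div_lt_iff₀ hγc).mp hNK
  have hNpos : (0 : ℝ) < N := by linarith
  have h1 : K * N < N * (γ * c ^ 2) * N := mul_lt_mul_of_pos_right hKN hNpos
  have h2 : γ * (c * N) ^ 2 = N * (γ * c ^ 2) * N := by ring
  have h3 : γ * (c * N) ^ 2 ≤ γ * X ^ 2 := mul_le_mul_of_nonneg_left hX2 hγ.le
  linarith

/-- **BridgeGlue** (item stmt-AtomisticToContinuum-13515 of route HiddenChargeMazur):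
`StaticKubo → ThomsonBound → DressedCharge → OpenMazurBridge`.  From `FouriersLawFor`: clause (i) gives
uniqueness of the weak steady state and (by choice) a steady-state family, clause (ii) the response limits
`D N → κ T`, hence bounded above; `DressedCharge` supplies `c, C, N₀` and, at a large `N`, the dressed `G, wL, wR`;
`StaticKubo` supplies `F` with `D N (N-1) T² = ∫ F J`; `ThomsonBound` then forces `γ c² N ≤ max (M T² C (1+γ²)) 0`,
contradicting the choice of `N`. -/
theorem hiddenChargeMazur_bridgeGlue_proof : BridgeGlue := by
  show StaticKubo → (ThomsonBound → (DressedCharge → OpenMazurBridge))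
  intro hK hT hD ω₂ lam β γ T hω hl hβ hγ hTpos P hP hcharge hFL
  -- the dressed charge: constants `c, C, N₀`
  obtain ⟨c, C, hc, N₀, hDC⟩ := hD ω₂ lam β γ T hω hl hβ hγ hTpos P hP hcharge
  -- Fourier's law for `P`: clause (i) and clause (ii)
  obtain ⟨hexu, κ, -, hresp⟩ := hFL
  have huniq : ∀ (N : ℕ) (T_L T_R : ℝ), 0 < T_L → 0 < T_R →
      ∀ μ ν : Measure (PhaseSpace N), P.IsSteadyState N T_L T_R μ →
        P.IsSteadyState N T_L T_R ν → μ = ν := by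
    intro N T_L T_R hL hR μ ν hμ hν
    obtain ⟨μ₀, -, hμ₀⟩ := hexu N T_L T_R hL hR
    rw [hμ₀ μ hμ, hμ₀ ν hν]
  classical
  obtain ⟨μf, hsteady⟩ : ∃ μf : (N : ℕ) → ℝ → ℝ → Measure (PhaseSpace N),
      ∀ (N : ℕ) (T_L T_R : ℝ), 0 < T_L → 0 < T_R → P.IsSteadyState N T_L T_R (μf N T_L T_R) := by
    refine ⟨fun N T_L T_R => if h : 0 < T_L ∧ 0 < T_R then
      Classical.choose (hexu N T_L T_R h.1 h.2) else 0, fun N T_L T_R hL hR => ?_⟩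
    have h : 0 < T_L ∧ 0 < T_R := ⟨hL, hR⟩
    simp only [dif_pos h]
    exact (Classical.choose_spec (hexu N T_L T_R h.1 h.2)).1
  obtain ⟨D, hDlim, hDtend⟩ := hresp μf hsteady T hTpos
  obtain ⟨M, hM⟩ := hDtend.bddAbove_range
  have hDM : ∀ N, D N ≤ M := fun N => hM (Set.mem_range_self N)
  -- choice of `N`
  set K : ℝ := max (M * T ^ 2 * (C * (1 + γ ^ 2))) 0 with hK_def
  obtain ⟨N, hNN₀, hN2, hNK⟩ : ∃ N : ℕ, N₀ ≤ N ∧ 2 ≤ N ∧ K / (γ * c ^ 2) < (N : ℝ) := by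
    refine ⟨max (max N₀ 2) (⌈K / (γ * c ^ 2)⌉₊ + 1), le_trans (le_max_left _ _) (le_max_left _ _),
      le_trans (le_max_right _ _) (le_max_left _ _), ?_⟩
    have h1 : K / (γ * c ^ 2) < ((⌈K / (γ * c ^ 2)⌉₊ + 1 : ℕ) : ℝ) := by
      push_cast
      exact lt_of_le_of_lt (Nat.le_ceil _) (lt_add_one _)
    have h2 : ((⌈K / (γ * c ^ 2)⌉₊ + 1 : ℕ) : ℝ) ≤ ((max (max N₀ 2) (⌈K / (γ * c ^ 2)⌉₊ + 1) : ℕ) : ℝ) := by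
      exact_mod_cast le_max_right _ _
    exact lt_of_lt_of_le h1 h2
  -- the dressed test functions at `N`
  obtain ⟨G, wL, wR, hG, hwL, hwR, ⟨C₂, θ₂, hθ₂, hgrowth₂⟩, hdress, hover, hleak⟩ := hDC N hNN₀
  -- the Poisson solution at `N`
  obtain ⟨F, hF, ⟨C₁, θ₁, hθ₁, hgrowth₁⟩, hgen, hident⟩ :=
    hK ω₂ lam β γ hω hl hβ hγ P hP huniq μf hsteady T hTpos N hN2 (D N) (hDlim N)
  -- one common growth pair (uses `H ≥ 0` for the pinned chain)
  have hH0 : ∀ z : PhaseSpace N, 0 ≤ P.hamiltonian N z := by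
    intro z
    rw [hP]
    exact pinnedChain_hamiltonian_nonneg hω.le hl.le hβ.le γ N z
  have hcommon : ∃ C θ : ℝ, θ < 1 / (2 * T) ∧ ∀ (z : PhaseSpace N) (i : Fin N),
      |F z| + |G z| + |wL z| + |wR z| + |partialP i F z| + |partialQ i F z| + |partialP i G z| +
        |partialQ i G z| + |partialP i wL z| + |partialQ i wL z| + |partialP i wR z| +
        |partialQ i wR z| ≤ C * Real.exp (θ * P.hamiltonian N z) := by
    refine ⟨max C₁ 0 + max C₂ 0, max θ₁ θ₂, max_lt hθ₁ hθ₂, fun z i => ?_⟩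
    have h1 := hgrowth₁ z i
    have h2 := hgrowth₂ z i
    have e1 : Real.exp (θ₁ * P.hamiltonian N z) ≤ Real.exp (max θ₁ θ₂ * P.hamiltonian N z) :=
      Real.exp_le_exp.mpr (mul_le_mul_of_nonneg_right (le_max_left _ _) (hH0 z))
    have e2 : Real.exp (θ₂ * P.hamiltonian N z) ≤ Real.exp (max θ₁ θ₂ * P.hamiltonian N z) :=
      Real.exp_le_exp.mpr (mul_le_mul_of_nonneg_right (le_max_right _ _) (hH0 z))
    have b1 : C₁ * Real.exp (θ₁ * P.hamiltonian N z) ≤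
        max C₁ 0 * Real.exp (max θ₁ θ₂ * P.hamiltonian N z) :=
      le_trans (mul_le_mul_of_nonneg_right (le_max_left _ _) (Real.exp_pos _).le)
        (mul_le_mul_of_nonneg_left e1 (le_max_right _ _))
    have b2 : C₂ * Real.exp (θ₂ * P.hamiltonian N z) ≤
        max C₂ 0 * Real.exp (max θ₁ θ₂ * P.hamiltonian N z) :=
      le_trans (mul_le_mul_of_nonneg_right (le_max_left _ _) (Real.exp_pos _).le)
        (mul_le_mul_of_nonneg_left e2 (le_max_right _ _))
    linarith
  -- the one-sided Thomson bound
  have hTh := hT ω₂ lam β γ T hω hl hβ hγ hTpos P hP N F G wL wR hF hG hwL hwR hcommon hgen hdress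
  -- the leak is nonnegative (a sum of integrals of squares)
  have hL0 : 0 ≤ T * ∑ i : Fin N,
      ((if i.val = 0 then ∫ z, (γ * partialP i G z + wL z) ^ 2
          ∂(volume.tilted fun x => -P.hamiltonian N x / T) else 0) +
        (if i.val = N - 1 then ∫ z, (γ * partialP i G z + wR z) ^ 2
          ∂(volume.tilted fun x => -P.hamiltonian N x / T) else 0)) := by
    refine mul_nonneg hTpos.le (Finset.sum_nonneg fun i _ => add_nonneg ?_ ?_)
    · split_ifs
      · exact integral_nonneg fun z => sq_nonneg _
      · exact le_rfl
    · split_ifs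
      · exact integral_nonneg fun z => sq_nonneg _
      · exact le_rfl
  exact hiddenChargeMazur_bridgeGlue_arith hγ hc hN2 hK_def hNK (hDM N) hident hTh hL0
    (hleak γ) hover

end Summit.AtomisticToContinuum.FouriersLaw.Theorems
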